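import Mathlib
import Literature.NumberTheory.LFunctions.Zhang2022.Section16Lemma162REuler
import Literature.NumberTheory.LFunctions.Zhang2022.Section16Lemma162RFactor
import Literature.Analysis.Complex.HolomorphicProducts
import HarnessLib

/-!
# Zhang (2022) §16 Lemma 16.2 at the repaired normaliser (GAP row G-d57-1), part 4: `E₂ⱼ(s)` continues
# analytically to `σ > 9/10` and is bounded there

Topic `Literature/NumberTheory/LFunctions/Zhang2022` (Landau–Siegel audit tree; verdict-neutral).
Y. Zhang, *Discrete mean estimates and the Landau–Siegel zero*, arXiv:2211.02515v1 (2022)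
[Zhang2022LandauSiegel] — **an unrefereed manuscript under adjudication; nothing here asserts or denies
its Theorems 1–2.** ZHANG-L WP16 block D, sub-leaf `Typed.Section16B.Lemma162R` (Lemma 16.2, §16 p. 94:
"the function `𝔲₂ⱼ(s)` … is analytic and bounded for `σ > 9/10`"; App. A pp. 105–106: "The proof is
(also) analogous to the Lemma 8.3, so we give a sketch only"). Theorems only; no definitions, no facts.

For a fixed modulus, a real (quadratic) character `χ`, an index `j`, under the numeric hypotheses
(H1) `‖F_q(1,1;1−β_j)‖ ≥ 1/2` at every odd prime, (H2) `‖ϖ₂ⱼ(2^e)‖ ≤ B(e+1)`, the Euler product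
`U(s) := ∏'_q Φ_q(s)` of parts 2–3 (`Lemma162R.hasProd_frakU2SeriesR`, `norm_Phi_sub_one_le`) is shown to be
* holomorphic on `σ > 9/10` (`differentiableOn_tprod_Phi`) — Weierstrass/Conway VII.5.9 through the lane's
  engine `Literature.Analysis.Complex.differentiableOn_tprod_of_norm_sub_one_le` (LIB D1), with the summable
  majorant `b_q = K·𝟙[q < 700 ∨ q ∣ D] + 30008500·q^{−9/5}` (`exists_majorant_Phi`);
* equal to `E₂ⱼ(s) = frakU2SeriesR c′ χ j s` for `σ > 1` (`tprod_Phi_eq_frakU2SeriesR`);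
* bounded on `σ > 9/10` (`norm_tprod_Phi_le`: `‖U(s)‖ ≤ exp(Σ_q b_q)`).
These are clauses (i)–(iii) of `Lemma162R` (`analytic_clauses`); clause (iv), the value at `s = 1`, is part 5.

## References

* Y. Zhang, arXiv:2211.02515v1 (2022), §16 Lemma 16.2 p. 94; App. A pp. 105–106.
  [cite: Zhang2022LandauSiegel, §16 Lemma 16.2 p.94]
* J. B. Conway, *Functions of One Complex Variable I*, VII.5.9 (via `Literature.Analysis.Complex.HolomorphicProducts`).
-/

noncomputable section

open Complex Real Finset Filter Topology

namespace Literature.NumberTheory.LFunctions.Zhang2022.Lemma162R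

open Literature.NumberTheory.LFunctions.Zhang2022
open Literature.NumberTheory.LFunctions.Zhang2022.Skeleton
open Literature.NumberTheory.LFunctions.Zhang2022.Typed.Section16A
open Literature.NumberTheory.LFunctions.Zhang2022.Typed.Section16B

variable (c' : ℝ) {D : ℕ} [NeZero D] (χ : DirichletCharacter ℂ D) (j : ℕ)

omit [NeZero D] in
/-- A prime `q` with `χ(q) = 0` divides the modulus (`χ` vanishes exactly at the non-units of `ZMod D`).
[cite: Zhang2022LandauSiegel, §16 p.92] -/
theorem dvd_of_apply_eq_zero {q : ℕ} (hq : q.Prime) (hv : χ (q : ZMod D) = 0) : q ∣ D := by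
  by_contra hnd
  have hcop : Nat.Coprime q D := (Nat.Prime.coprime_iff_not_dvd hq).mpr hnd
  have hu : IsUnit (q : ZMod D) := (ZMod.isUnit_iff_coprime q D).mpr hcop
  exact (hu.map χ).ne_zero hv

omit [NeZero D] in
/-- For a quadratic `χ` and a prime `q ∤ D`: `χ(q) = ±1`. [cite: Zhang2022LandauSiegel, §16 p.92] -/
theorem apply_eq_one_or_neg_one (hχ : χ.IsQuadratic) {q : ℕ} (hq : q.Prime) (hqD : ¬ q ∣ D) :
    χ (q : ZMod D) = 1 ∨ χ (q : ZMod D) = -1 := by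
  rcases hχ (q : ZMod D) with h | h | h
  · exact absurd (dvd_of_apply_eq_zero χ hq h) hqD
  · exact Or.inl h
  · exact Or.inr h

/-- **The summable majorant of `Φ_q − 1` on `σ > 9/10`** (under (H1), (H2), `χ` quadratic):
`b_q = (8568002 + 4080B)·𝟙[q < 700 ∨ q ∣ D] + 30008500·q^{−9/5}`, with `‖Φ_q(s) − 1‖ ≤ b_q` for every prime `q`
and every `s` with `σ > 9/10` (crude bounds at the finitely many exceptional primes, `norm_Phi_sub_one_le`
at the others). [cite: Zhang2022LandauSiegel, §16 Lemma 16.2 p.94, App. A p.105] -/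
theorem exists_majorant_Phi (hχ : χ.IsQuadratic)
    (hF : ∀ q : ℕ, q.Prime → q ≠ 2 → 1 / 2 ≤ ‖calM2Factor c' χ q 1 1 (1 - betaJ c' D j)‖)
    {B : ℝ} (hB0 : 0 ≤ B) (hB : ∀ e : ℕ, ‖varpi2 c' χ j (2 ^ e)‖ ≤ B * ((e : ℝ) + 1)) :
    ∃ b : Nat.Primes → ℝ, Summable b ∧ (∀ q, 0 ≤ b q) ∧ ∀ (q : Nat.Primes) (s : ℂ), 9 / 10 < s.re →
      ‖(1 - ((q : ℕ) : ℂ) ^ (-s)) ^ 2 * (1 - ((q : ℕ) : ℂ) ^ betaJ c' D j * ((q : ℕ) : ℂ) ^ (-s)) *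
            (1 - χ ((q : ℕ) : ZMod D) * ((q : ℕ) : ℂ) ^ (-s)) *
              (1 - χ ((q : ℕ) : ZMod D) * (((q : ℕ) : ℂ) ^ betaJ c' D j * ((q : ℕ) : ℂ) ^ (-s))) ^ 2 *
          (if (q : ℕ) = 2 then ∑' e : ℕ, varpi2 c' χ j (2 ^ e) * nuConvChi χ (2 ^ e) * ((2 : ℂ) ^ (-s)) ^ e
            else ∑' e : ℕ, varpi2loc c' χ j ((q : ℕ) ^ e) * nuConvChi χ ((q : ℕ) ^ e) * (((q : ℕ) : ℂ) ^ (-s)) ^ e)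
          - 1‖ ≤ b q := by
  classical
  -- the finite exceptional set
  set S : Finset Nat.Primes := ((Finset.range 700).filter Nat.Prime ∪ D.primeFactors).subtype Nat.Prime with hS
  have hmemS : ∀ q : Nat.Primes, q ∈ S ↔ (q : ℕ) < 700 ∨ (q : ℕ) ∣ D := by
    intro q
    have h : q ∈ S ↔ (q : ℕ) ∈ (Finset.range 700).filter Nat.Prime ∪ D.primeFactors := Finset.mem_subtype
    rw [h, Finset.mem_union, Finset.mem_filter, Finset.mem_range, Nat.mem_primeFactors]
    constructor
    · rintro (⟨h, -⟩ | ⟨-, h, -⟩)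
      · exact Or.inl h
      · exact Or.inr h
    · rintro (h | h)
      · exact Or.inl ⟨h, q.prop⟩
      · exact Or.inr ⟨q.prop, h, NeZero.ne D⟩
  set K : ℝ := 8568002 + 4080 * B with hK
  have hK0 : 0 ≤ K := by rw [hK]; positivity
  set b : Nat.Primes → ℝ := fun q => (if q ∈ S then K else 0) + 30008500 * ((q : ℕ) : ℝ) ^ (-(9 / 5 : ℝ)) with hb
  have hbS : Summable fun q : Nat.Primes => (if q ∈ S then K else (0 : ℝ)) := by
    refine summable_of_ne_finset_zero (s := S) fun q hq => ?_
    rw [if_neg hq]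
  have hbT : Summable fun q : Nat.Primes => 30008500 * ((q : ℕ) : ℝ) ^ (-(9 / 5 : ℝ)) :=
    (Nat.Primes.summable_rpow.mpr (by norm_num)).mul_left _
  refine ⟨b, hbS.add hbT, fun q => ?_, fun q s hs => ?_⟩
  · have : 0 ≤ 30008500 * ((q : ℕ) : ℝ) ^ (-(9 / 5 : ℝ)) := by positivity
    show 0 ≤ (if q ∈ S then K else 0) + 30008500 * ((q : ℕ) : ℝ) ^ (-(9 / 5 : ℝ))
    split_ifs <;> linarith
  have hq : (q : ℕ).Prime := q.prop
  have hpos : 0 ≤ 30008500 * ((q : ℕ) : ℝ) ^ (-(9 / 5 : ℝ)) := by positivity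
  show _ ≤ (if q ∈ S then K else 0) + 30008500 * ((q : ℕ) : ℝ) ^ (-(9 / 5 : ℝ))
  by_cases hqS : q ∈ S
  · rw [if_pos hqS]
    -- crude bounds
    by_cases h2 : (q : ℕ) = 2
    · rw [if_pos h2]
      have h := norm_Phi_two_sub_one_le_crude c' χ j hB hs
      have e2 : ((q : ℕ) : ℂ) = (2 : ℂ) := by rw [h2]; norm_num
      have e2' : ((q : ℕ) : ZMod D) = (2 : ZMod D) := by rw [h2]; norm_num
      rw [e2, e2']
      linarith
    · rw [if_neg h2]
      have h := norm_Phi_sub_one_le_crude c' χ j hq (hF q hq h2) hs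
      linarith
  · rw [if_neg hqS, zero_add]
    have hnot := (hmemS q).not.mp hqS
    have h700 : 700 ≤ (q : ℕ) := not_lt.mp fun h => hnot (Or.inl h)
    have hnd : ¬ (q : ℕ) ∣ D := fun h => hnot (Or.inr h)
    have h2 : (q : ℕ) ≠ 2 := by omega
    have hv := apply_eq_one_or_neg_one χ hχ hq hnd
    rw [if_neg h2]
    have h := norm_Phi_sub_one_le c' χ j hq h700 hv hs
    obtain ⟨hx1, hx2⟩ := norm_x_bounds hq hs
    calc _ ≤ 8500 * ‖((q : ℕ) : ℂ) ^ (-s)‖ / (q : ℕ) + 30000000 * ‖((q : ℕ) : ℂ) ^ (-s)‖ ^ 2 := h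
      _ ≤ 8500 * ((q : ℕ) : ℝ) ^ (-(9 / 5 : ℝ)) + 30000000 * ((q : ℕ) : ℝ) ^ (-(9 / 5 : ℝ)) := by
          rw [mul_div_assoc]; gcongr
      _ = 30008500 * ((q : ℕ) : ℝ) ^ (-(9 / 5 : ℝ)) := by ring

/-- **Each Euler factor `Φ_q` is holomorphic on `σ > 9/10`.** [cite: Zhang2022LandauSiegel, §16 Lemma 16.2 p.94] -/
theorem differentiableOn_Phi
    (hF : ∀ q : ℕ, q.Prime → q ≠ 2 → 1 / 2 ≤ ‖calM2Factor c' χ q 1 1 (1 - betaJ c' D j)‖)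
    {B : ℝ} (hB : ∀ e : ℕ, ‖varpi2 c' χ j (2 ^ e)‖ ≤ B * ((e : ℝ) + 1)) (q : Nat.Primes) :
    DifferentiableOn ℂ (fun s : ℂ =>
      (1 - ((q : ℕ) : ℂ) ^ (-s)) ^ 2 * (1 - ((q : ℕ) : ℂ) ^ betaJ c' D j * ((q : ℕ) : ℂ) ^ (-s)) *
            (1 - χ ((q : ℕ) : ZMod D) * ((q : ℕ) : ℂ) ^ (-s)) *
              (1 - χ ((q : ℕ) : ZMod D) * (((q : ℕ) : ℂ) ^ betaJ c' D j * ((q : ℕ) : ℂ) ^ (-s))) ^ 2 *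
          (if (q : ℕ) = 2 then ∑' e : ℕ, varpi2 c' χ j (2 ^ e) * nuConvChi χ (2 ^ e) * ((2 : ℂ) ^ (-s)) ^ e
            else ∑' e : ℕ, varpi2loc c' χ j ((q : ℕ) ^ e) * nuConvChi χ ((q : ℕ) ^ e) * (((q : ℕ) : ℂ) ^ (-s)) ^ e))
      {s : ℂ | 9 / 10 < s.re} := by
  have hq : (q : ℕ).Prime := q.prop
  refine (differentiable_Nq c' χ j hq).differentiableOn.mul ?_
  by_cases h2 : (q : ℕ) = 2
  · simp only [h2, if_true]
    exact differentiableOn_C2 c' χ j hB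
  · simp only [h2, if_false]
    exact differentiableOn_Cq c' χ j hq (hF q hq h2)

/-- **`U(s) = ∏'_q Φ_q(s)` is holomorphic on `σ > 9/10`** (clause (i) of Lemma 16.2 at the repaired
normaliser; LIB D1 `differentiableOn_tprod_of_norm_sub_one_le` with the majorant of `exists_majorant_Phi`).
[cite: Zhang2022LandauSiegel, §16 Lemma 16.2 p.94] -/
theorem differentiableOn_tprod_Phi (hχ : χ.IsQuadratic)
    (hF : ∀ q : ℕ, q.Prime → q ≠ 2 → 1 / 2 ≤ ‖calM2Factor c' χ q 1 1 (1 - betaJ c' D j)‖)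
    {B : ℝ} (hB0 : 0 ≤ B) (hB : ∀ e : ℕ, ‖varpi2 c' χ j (2 ^ e)‖ ≤ B * ((e : ℝ) + 1)) :
    DifferentiableOn ℂ (fun s : ℂ => ∏' q : Nat.Primes,
      (1 - ((q : ℕ) : ℂ) ^ (-s)) ^ 2 * (1 - ((q : ℕ) : ℂ) ^ betaJ c' D j * ((q : ℕ) : ℂ) ^ (-s)) *
            (1 - χ ((q : ℕ) : ZMod D) * ((q : ℕ) : ℂ) ^ (-s)) *
              (1 - χ ((q : ℕ) : ZMod D) * (((q : ℕ) : ℂ) ^ betaJ c' D j * ((q : ℕ) : ℂ) ^ (-s))) ^ 2 *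
          (if (q : ℕ) = 2 then ∑' e : ℕ, varpi2 c' χ j (2 ^ e) * nuConvChi χ (2 ^ e) * ((2 : ℂ) ^ (-s)) ^ e
            else ∑' e : ℕ, varpi2loc c' χ j ((q : ℕ) ^ e) * nuConvChi χ ((q : ℕ) ^ e) * (((q : ℕ) : ℂ) ^ (-s)) ^ e))
      {s : ℂ | 9 / 10 < s.re} := by
  obtain ⟨b, hb, -, hle⟩ := exists_majorant_Phi c' χ j hχ hF hB0 hB
  exact Literature.Analysis.Complex.differentiableOn_tprod_of_norm_sub_one_le
    (isOpen_lt continuous_const Complex.continuous_re) (fun q => differentiableOn_Phi c' χ j hF hB q) hb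
    (fun q s hs => hle q s hs)

/-- **`U(s) = E₂ⱼ(s)` for `σ > 1`** (clause (ii): the Euler product of part 2).
[cite: Zhang2022LandauSiegel, §16 Lemma 16.2 p.94] -/
theorem tprod_Phi_eq_frakU2SeriesR
    (hF : ∀ q : ℕ, q.Prime → q ≠ 2 → 1 / 2 ≤ ‖calM2Factor c' χ q 1 1 (1 - betaJ c' D j)‖)
    {B : ℝ} (hB0 : 0 ≤ B) (hB : ∀ e : ℕ, ‖varpi2 c' χ j (2 ^ e)‖ ≤ B * ((e : ℝ) + 1)) {s : ℂ} (hs : 1 < s.re) :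
    (∏' q : Nat.Primes,
      (1 - ((q : ℕ) : ℂ) ^ (-s)) ^ 2 * (1 - ((q : ℕ) : ℂ) ^ betaJ c' D j * ((q : ℕ) : ℂ) ^ (-s)) *
            (1 - χ ((q : ℕ) : ZMod D) * ((q : ℕ) : ℂ) ^ (-s)) *
              (1 - χ ((q : ℕ) : ZMod D) * (((q : ℕ) : ℂ) ^ betaJ c' D j * ((q : ℕ) : ℂ) ^ (-s))) ^ 2 *
          (if (q : ℕ) = 2 then ∑' e : ℕ, varpi2 c' χ j (2 ^ e) * nuConvChi χ (2 ^ e) * ((2 : ℂ) ^ (-s)) ^ e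
            else ∑' e : ℕ, varpi2loc c' χ j ((q : ℕ) ^ e) * nuConvChi χ ((q : ℕ) ^ e) * (((q : ℕ) : ℂ) ^ (-s)) ^ e))
      = frakU2SeriesR c' χ j s :=
  (hasProd_frakU2SeriesR c' χ j hF hB0 hB hs).tprod_eq

/-- **`U(s)` is bounded on `σ > 9/10`** (clause (iii)): `‖U(s)‖ ≤ exp(Σ_q b_q)`.
[cite: Zhang2022LandauSiegel, §16 Lemma 16.2 p.94] -/
theorem norm_tprod_Phi_le (hχ : χ.IsQuadratic)
    (hF : ∀ q : ℕ, q.Prime → q ≠ 2 → 1 / 2 ≤ ‖calM2Factor c' χ q 1 1 (1 - betaJ c' D j)‖)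
    {B : ℝ} (hB0 : 0 ≤ B) (hB : ∀ e : ℕ, ‖varpi2 c' χ j (2 ^ e)‖ ≤ B * ((e : ℝ) + 1)) :
    ∃ B' : ℝ, ∀ s : ℂ, 9 / 10 < s.re → ‖∏' q : Nat.Primes,
      (1 - ((q : ℕ) : ℂ) ^ (-s)) ^ 2 * (1 - ((q : ℕ) : ℂ) ^ betaJ c' D j * ((q : ℕ) : ℂ) ^ (-s)) *
            (1 - χ ((q : ℕ) : ZMod D) * ((q : ℕ) : ℂ) ^ (-s)) *
              (1 - χ ((q : ℕ) : ZMod D) * (((q : ℕ) : ℂ) ^ betaJ c' D j * ((q : ℕ) : ℂ) ^ (-s))) ^ 2 *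
          (if (q : ℕ) = 2 then ∑' e : ℕ, varpi2 c' χ j (2 ^ e) * nuConvChi χ (2 ^ e) * ((2 : ℂ) ^ (-s)) ^ e
            else ∑' e : ℕ, varpi2loc c' χ j ((q : ℕ) ^ e) * nuConvChi χ ((q : ℕ) ^ e) * (((q : ℕ) : ℂ) ^ (-s)) ^ e)‖
      ≤ B' := by
  obtain ⟨b, hb, -, hle⟩ := exists_majorant_Phi c' χ j hχ hF hB0 hB
  refine ⟨Real.exp (∑' q, b q), fun s hs => ?_⟩
  exact Literature.Analysis.Complex.norm_tprod_le_exp_tsum (U := {s : ℂ | 9 / 10 < s.re})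
    (F := fun (q : Nat.Primes) (s : ℂ) =>
      (1 - ((q : ℕ) : ℂ) ^ (-s)) ^ 2 * (1 - ((q : ℕ) : ℂ) ^ betaJ c' D j * ((q : ℕ) : ℂ) ^ (-s)) *
            (1 - χ ((q : ℕ) : ZMod D) * ((q : ℕ) : ℂ) ^ (-s)) *
              (1 - χ ((q : ℕ) : ZMod D) * (((q : ℕ) : ℂ) ^ betaJ c' D j * ((q : ℕ) : ℂ) ^ (-s))) ^ 2 *
          (if (q : ℕ) = 2 then ∑' e : ℕ, varpi2 c' χ j (2 ^ e) * nuConvChi χ (2 ^ e) * ((2 : ℂ) ^ (-s)) ^ e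
            else ∑' e : ℕ, varpi2loc c' χ j ((q : ℕ) ^ e) * nuConvChi χ ((q : ℕ) ^ e) * (((q : ℕ) : ℂ) ^ (-s)) ^ e))
    hb (fun q s hs => hle q s hs) hs

/-- **Clauses (i)–(iii) of `Lemma162R` for a fixed `(D, χ, j)`** under (H1), (H2), `χ` quadratic: there is
`U` (the Euler product `∏'_q Φ_q`), holomorphic and bounded on `σ > 9/10`, equal to `frakU2SeriesR c′ χ j`
on `σ > 1`. [cite: Zhang2022LandauSiegel, §16 Lemma 16.2 p.94] -/
theorem analytic_clauses (hχ : χ.IsQuadratic)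
    (hF : ∀ q : ℕ, q.Prime → q ≠ 2 → 1 / 2 ≤ ‖calM2Factor c' χ q 1 1 (1 - betaJ c' D j)‖)
    {B : ℝ} (hB0 : 0 ≤ B) (hB : ∀ e : ℕ, ‖varpi2 c' χ j (2 ^ e)‖ ≤ B * ((e : ℝ) + 1)) :
    DifferentiableOn ℂ (fun s : ℂ => ∏' q : Nat.Primes,
      (1 - ((q : ℕ) : ℂ) ^ (-s)) ^ 2 * (1 - ((q : ℕ) : ℂ) ^ betaJ c' D j * ((q : ℕ) : ℂ) ^ (-s)) *
            (1 - χ ((q : ℕ) : ZMod D) * ((q : ℕ) : ℂ) ^ (-s)) *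
              (1 - χ ((q : ℕ) : ZMod D) * (((q : ℕ) : ℂ) ^ betaJ c' D j * ((q : ℕ) : ℂ) ^ (-s))) ^ 2 *
          (if (q : ℕ) = 2 then ∑' e : ℕ, varpi2 c' χ j (2 ^ e) * nuConvChi χ (2 ^ e) * ((2 : ℂ) ^ (-s)) ^ e
            else ∑' e : ℕ, varpi2loc c' χ j ((q : ℕ) ^ e) * nuConvChi χ ((q : ℕ) ^ e) * (((q : ℕ) : ℂ) ^ (-s)) ^ e))
      {s : ℂ | 9 / 10 < s.re} ∧
    (∀ s : ℂ, 1 < s.re → (∏' q : Nat.Primes,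
      (1 - ((q : ℕ) : ℂ) ^ (-s)) ^ 2 * (1 - ((q : ℕ) : ℂ) ^ betaJ c' D j * ((q : ℕ) : ℂ) ^ (-s)) *
            (1 - χ ((q : ℕ) : ZMod D) * ((q : ℕ) : ℂ) ^ (-s)) *
              (1 - χ ((q : ℕ) : ZMod D) * (((q : ℕ) : ℂ) ^ betaJ c' D j * ((q : ℕ) : ℂ) ^ (-s))) ^ 2 *
          (if (q : ℕ) = 2 then ∑' e : ℕ, varpi2 c' χ j (2 ^ e) * nuConvChi χ (2 ^ e) * ((2 : ℂ) ^ (-s)) ^ e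
            else ∑' e : ℕ, varpi2loc c' χ j ((q : ℕ) ^ e) * nuConvChi χ ((q : ℕ) ^ e) * (((q : ℕ) : ℂ) ^ (-s)) ^ e))
      = frakU2SeriesR c' χ j s) ∧
    (∃ B' : ℝ, ∀ s : ℂ, 9 / 10 < s.re → ‖∏' q : Nat.Primes,
      (1 - ((q : ℕ) : ℂ) ^ (-s)) ^ 2 * (1 - ((q : ℕ) : ℂ) ^ betaJ c' D j * ((q : ℕ) : ℂ) ^ (-s)) *
            (1 - χ ((q : ℕ) : ZMod D) * ((q : ℕ) : ℂ) ^ (-s)) *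
              (1 - χ ((q : ℕ) : ZMod D) * (((q : ℕ) : ℂ) ^ betaJ c' D j * ((q : ℕ) : ℂ) ^ (-s))) ^ 2 *
          (if (q : ℕ) = 2 then ∑' e : ℕ, varpi2 c' χ j (2 ^ e) * nuConvChi χ (2 ^ e) * ((2 : ℂ) ^ (-s)) ^ e
            else ∑' e : ℕ, varpi2loc c' χ j ((q : ℕ) ^ e) * nuConvChi χ ((q : ℕ) ^ e) * (((q : ℕ) : ℂ) ^ (-s)) ^ e)‖
      ≤ B') :=
  ⟨differentiableOn_tprod_Phi c' χ j hχ hF hB0 hB, fun _ hs => tprod_Phi_eq_frakU2SeriesR c' χ j hF hB0 hB hs,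
    norm_tprod_Phi_le c' χ j hχ hF hB0 hB⟩

end Literature.NumberTheory.LFunctions.Zhang2022.Lemma162R

end
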